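import Literature.MathematicalPhysics.QuantumFieldTheory.Balaban1983to89.Node00.TkNoExpansionAtRecord13
import Literature.MathematicalPhysics.QuantumFieldTheory.Balaban1983to89.Node00.StepWeightsAtNoExpansion

/-!
# NODE 00 (YM-PLAN Track A) — THE RUN-INDEXED RESIDUAL 𝐓-WEIGHT FAMILY OF RECORD `ZrOfRecord₁₃ θ p` (director-ym №169 ∕ №174 (5), FINDING №8 = node00-def-T's LOCATED-8
# «the slot `Stage12Params.Zt K` is RUN-BLIND, print's `ζ(Ω_{j+1})` reads the run»): dag-n11-d's DIAGONAL CURE made a definition of record — at every generation `j < K` of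
# the run `p`, `ζ0_j(T)(ω) := w_j(s′_j(p))(V_j, V̄_j)` (def-T's resummed step weight (3.2)–(3.5)·(3.16)·(3.20) of the ALL-LARGE-FIELD new sequence of length `j+1`, read
# on the scale-`j` averaging graph), `ζ0_j(∅) := 1 − ζ0_j(T)`, `ζ0_j(Y) := 0` otherwise, node00-def-K0b's uniform factor at `j ≥ K`, `quad := 0` — with its three laws
# (12a's `ζ0 ≥ 0`, 12b's locality, print's partition of unity) as THEOREMS, and the pin faces dag-n11-d's spec theorems take as hypotheses

Cell `pub-ymgap`, seat `pub-ymgap-node00-def-K0a` (g9), FILE 17 (the v1.6 `Zr` pin; director-ym №174 (5) «K0a∕K0b successors: re-pin `Zr` with n11-d's generation-0 pin +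
uniform at j ≥ 1 (def-T P4 ∕ n11-d 4a–4c) when v1.6 lands»; node00-def-T memo `LOCATED-8-ZtRunBlind-DESIGN-g18.md` §6: «under H1 the K0b∕K0a pin of the run-indexed slot
`θ.Zr p` is exactly n11-d's diagonal family … ONE run-indexed datum per run, above the node split»).  This file is typed against the v1.5 objects ONLY (12a's
`TkResidualW`, def-T's `wOfRecord₉`, r11's (2.18) index `SeqOfRecord`) — it needs NO `Stage13RParams` and serves node00-def-T's v1.6 `Record13CoPR` ∕ `Record13SepCoPR`
(`structure Stage13RParams extends Stage13Params` + `Zr : (p : B12.RunParams) → TkResidualW Fam N (FluctV N) p.K`, rows `zrLaws ∕ zrLocal`, guard `ZrUnity`) as the VALUE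
of the new field at node00-def-K0a's witness families: `Zr := ZrOfRecord₁₃ F N θ₀` (θ₀ = the Stage-13 part), rows and guard discharged by §3 below.
[III] = [Balaban1988Convergent], [I] = [Balaban1987RG1].

WHY (one paragraph).  dag-n11-d (`Summits/…/BalabanUVNodesN11NoExpansionZetaSpec[AtCoP∕Succ]`, p522000 ∕ p523822 ∕ p526…) proved, GENERICALLY in the weight family:
on the no-expansion diagonal (new sequences with `Ω_{j+1}(s′) = ∅`) the (3.25) identity of the 𝐓-image §2 form holds `dV′`-a.e. AS SOON AS the generation-`j`
factor `ζ_j(T)·w_j(∅,∅,∅)` of the family, read at the two-scale configuration `(V_j, V_{j+1}) = (U, Ū)`, IS `w_j(s′)(U, Ū)`; and that a residual PINNED to that value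
(complement on `∅`, zero elsewhere, `quad_j(∅) = 0`) obeys 12a's law, 12b's locality law and print's partition of unity (`exists_residual_clause_one_CoP`, by
choice, run by run).  node00-def-T's LOCATED-8 ∕ director-ym №169: that pin READS THE RUN (`w_j(s′)` carries `ε_j(g_j)`, `δ_j(g_j)`; [III] (1.11) p. 248 «ζ(Ω₁ᶜ) …
resummed over all admissible P₀, P₁, Q₁» of the RUN's decomposition), so it is typable only in a RUN-INDEXED slot — the v1.6 field `Zr p`.  This file supplies the
explicit family, ONE definition for all runs and all generations, so that the v1.6 witness is a term and not a choice.

WHAT THIS FILE DEFINES ∕ PROVES (3 `def`, theorems otherwise).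
§1 `seqAllLargeOfRecord F ν M g K k : SeqOfRecord F ν M g K k` — THE ALL-LARGE-FIELD (2.18) INDEX of length `k`: `Ω_j = Λ_j = ∅` for every `j` (admissible: `∅` is a
   union of no `𝐃_j`-cubes, `empty_mem_unionsOfCubes`); faces `_Ω`, `_Λ` (`rfl`).
§2 `stepWeightPinOfRecord₁₃ F N θ p j ω : ℝ := wOfRecord₉ F N θ.toStage9Params p (gOfRecord₁₃ F N θ p) j (seqAllLargeOfRecord … p.K (j+1)) (ω j).1 (avg_j (ω j).1)` — the
   generation-`j` PIN VALUE on the averaging graph (dag-n11-d §3∕§4's `a`, now along the whole diagonal); faces: `_local` (reads `ω j` only), `_nonneg` ∕ `_le_one` (under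
   unity of def-T's label residual `θ.ζ`: `wOfRecord_nonneg∕le_one_of_Omega_empty`), `_pairCfgAt` ∕ `_pairCfg` (its value at the two-scale configurations of 11a∕g3).
§3 ★★★ `ZrOfRecord₁₃ F N θ p : TkResidualW F N (FluctV N) p.K` — THE RUN-INDEXED RESIDUAL OF RECORD (docstring above); unfolding faces `ZrOfRecord₁₃_ζ0_univ ∕ _ζ0_empty ∕
   _ζ0_of_ne_of_ne` (`j < K`), `_ζ0_of_le` (`K ≤ j`: K0b's `ZtOfRecord`), `_quad`; THE THREE LAWS ★ `laws_ZrOfRecord₁₃ (hζu : IsZetaUnity F N θ.ν θ.τ9.M θ.ζ)` (12a's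
   `TkResidualW.Laws`), ★ `localLaws_ZrOfRecord₁₃` (12b's `TkResidualW.LocalLaws`), ★ `finsum_ζ0_ZrOfRecord₁₃` (print's partition of unity `Σᶠ_Y ζ0 j Y ω = 1` at EVERY
   generation — the future guard `Stage13RParams.ZrUnity` at the pin); THE PIN FACES for dag-n11-d's hypotheses `hZ`∕`hq`: `ZrOfRecord₁₃_ζ0_zero_univ_pairCfg` (`0 < K`),
   `ZrOfRecord₁₃_ζ0_univ_pairCfgAt` (`j < K`), `ZrOfRecord₁₃_quad_pairCfg[At]`.

HONEST FRAMING.  Definitions of record + kernel bookkeeping (`rfl`, `if_pos∕if_neg`, one two-point `Finset` sum).  The pin is dag-n11-d's cure family verbatim, made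
total in `(p, j, Y, ω)`; it is NOT print's (1.11) ∕ (3.16)–(3.20) resummation as a FORMULA over admissible `(P, Q, R, S)` for general `Y` (node00-def-T's H3, not in the
tree) — it AGREES with def-T's resummed step weight on the no-expansion diagonal's averaging graph, which is all dag-n11-d's spec reads; off the diagonal (`Y ∉ {T, ∅}`)
it is `0` by fiat (located, not print).  Nothing of Bałaban asserted: NOT that any `TLaw` holds (dag-n11-d's theorems + this pin give the no-expansion DIAGONAL only;
the sequences with `Ω_{j+1} ≠ ∅` are [III] §3 ∕ Thm 1 proper), NOT a K0⁶ witness (node00-def-T's v1.6 files first; then FILE 16aᴿ).  Counts unmoved (typed 28∕28 ·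
discharged 5∕28); one finite 𝕋⁴ programme at fixed ε — NOT continuum ∕ OS ∕ mass gap ∕ Clay.  No `sorry`, `axiom`, `instance`, `notation`.
-/

noncomputable section

open MeasureTheory
open scoped BigOperators Matrix.Norms.L2Operator

namespace Literature.MathematicalPhysics.QuantumFieldTheory.Balaban1983to89.Node00

open T4Continuum B14.Eq218Concrete B15DeterminingSets Tk

/-! ## §1. The all-large-field (2.18) index: `Ω_j = Λ_j = ∅` for every `j` -/

section AllLarge

variable (F : T4Family)

/-- **THE ALL-LARGE-FIELD INDEX OF LENGTH `k`** — the (2.18) summation index with EVERY small-field region empty, `Ω_j = Λ_j = ∅` (`j = 1, …, k`; and `∅` off the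
window, as every index): admissible along (2.1) because `∅` is a union of (no) `𝐃_j`-cubes.  It is the «no expansion at any step» term of (2.18) — the new sequence
`s′` of dag-n11-d's spec theorems at every level. [cite: Balaban1988Convergent, (2.1) p.254, (2.18) p.257, (2.22) p.258] -/
def seqAllLargeOfRecord (ν : Stage7Numerics) (M : ℕ) (g : ℕ → ℝ) (K k : ℕ) : SeqOfRecord F ν M g K k where
  Ω := fun _ => ∅
  Λ := fun _ => ∅
  chain :=
    { memΩ := fun j _ _ => by unfold DOfRecord; exact empty_mem_unionsOfCubes _ _
      memΛ := fun j _ _ => by unfold DOfRecord; exact empty_mem_unionsOfCubes _ _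
      Λ_subset := fun _ _ _ => le_rfl
      Ω_succ_subset := fun _ _ _ => le_rfl }
  Ω_off := fun _ _ => rfl
  Λ_off := fun _ _ => rfl

/-- Every `Ω_j` of the all-large-field index is empty (`rfl`). [cite: Balaban1988Convergent, (2.1) p.254 (bookkeeping)] -/
@[simp] theorem seqAllLargeOfRecord_Ω (ν : Stage7Numerics) (M : ℕ) (g : ℕ → ℝ) (K k j : ℕ) : (seqAllLargeOfRecord F ν M g K k).Ω j = ∅ := rfl

/-- Every `Λ_j` of the all-large-field index is empty (`rfl`). [cite: Balaban1988Convergent, (2.1) p.254 (bookkeeping)] -/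
@[simp] theorem seqAllLargeOfRecord_Λ (ν : Stage7Numerics) (M : ℕ) (g : ℕ → ℝ) (K k j : ℕ) : (seqAllLargeOfRecord F ν M g K k).Λ j = ∅ := rfl

end AllLarge

/-! ## §2. The generation-`j` pin value on the scale-`j` averaging graph -/

section PinValue

variable (F : T4Family) (N : ℕ) [NeZero N] (θ : Stage13Params F N) (p : B12.RunParams)

/-- **THE GENERATION-`j` PIN VALUE** `ω ↦ w_j(s′_j(p))(V_j, V̄_j)`: def-T's resummed 𝐓-step weight ((3.2)–(3.5)·(3.16)·(3.20), Stage 9 `wOfRecord₉`) of the run `p` at level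
`j`, for the ALL-LARGE-FIELD new sequence of length `j+1`, read at the scale-`j` gauge variables `V_j = (ω j).1` and their one-step average `V̄_j` (the averaging of
record).  dag-n11-d's `a` (§3 of `…N11NoExpansionZetaSpecAtCoP`) is the case `j = 0`. It READS THE RUN (`ε_j(g_j)`, `δ_j(g_j)`; [III] (2.4), (3.2)–(3.4)).
[cite: Balaban1988Convergent, (1.11) p.248, (3.2)–(3.5) pp.264–265, (3.16) p.268, (3.20) p.269, p.267] -/
def stepWeightPinOfRecord₁₃ (j : ℕ) (ω : MultiCfg (F.P p.K) (SU N) (FluctV N)) : ℝ :=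
  wOfRecord₉ F N θ.toStage9Params p (gOfRecord₁₃ F N θ p) j (seqAllLargeOfRecord F θ.ν θ.τ9.M (gOfRecord₁₃ F N θ p) p.K (j + 1))
    (ω j).1 ((avOfRecord F N p.K j).avg (ω j).1)

variable {F N θ p}

/-- **THE PIN VALUE IS LOCAL AT SCALE `j`** (12b's `LocalLaws` shape): it reads `ω j` only. [cite: Balaban1988Convergent, (3.2)–(3.3) p.265, p.267] -/
theorem stepWeightPinOfRecord₁₃_local (j : ℕ) {ω ω' : MultiCfg (F.P p.K) (SU N) (FluctV N)} (h : ω j = ω' j) :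
    stepWeightPinOfRecord₁₃ F N θ p j ω = stepWeightPinOfRecord₁₃ F N θ p j ω' := by
  unfold stepWeightPinOfRecord₁₃
  rw [h]

/-- **THE PIN VALUE IS NONNEGATIVE** under unity of def-T's label residual `ζ` (`wOfRecord_nonneg_of_Omega_empty` at the all-large-field sequence).
[cite: Balaban1988Convergent, (3.2)–(3.3) p.265, (3.16) p.268] -/
theorem stepWeightPinOfRecord₁₃_nonneg (hζu : IsZetaUnity F N θ.ν θ.τ9.M θ.ζ) (j : ℕ) (ω : MultiCfg (F.P p.K) (SU N) (FluctV N)) :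
    0 ≤ stepWeightPinOfRecord₁₃ F N θ p j ω :=
  wOfRecord_nonneg_of_Omega_empty F N θ.ν θ.τ9.M θ.A₁ p (gOfRecord₁₃ F N θ p) j hζu _ rfl _ _

/-- **THE PIN VALUE IS AT MOST ONE** under unity of def-T's label residual `ζ` (`wOfRecord_le_one_of_Omega_empty`). [cite: Balaban1988Convergent, (3.2)–(3.3) p.265, (3.16) p.268] -/
theorem stepWeightPinOfRecord₁₃_le_one (hζu : IsZetaUnity F N θ.ν θ.τ9.M θ.ζ) (j : ℕ) (ω : MultiCfg (F.P p.K) (SU N) (FluctV N)) :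
    stepWeightPinOfRecord₁₃ F N θ p j ω ≤ 1 :=
  wOfRecord_le_one_of_Omega_empty F N θ.ν θ.τ9.M θ.A₁ p (gOfRecord₁₃ F N θ p) j hζu _ rfl _ _

/-- **THE PIN VALUE AT g3's TWO-SCALE CONFIGURATION `(V_j, V_{j+1}) = (U, V′)`** is `w_j(s′_j)(U, Ū)` — dag-n11-d's spec hypothesis shape at generation `j`.
[cite: Balaban1988Convergent, (2.21) p.258, (3.24) p.270 (bookkeeping)] -/
theorem stepWeightPinOfRecord₁₃_pairCfgAt (j : ℕ) (V' : GaugeField (F.P p.K) (j + 1) (SU N)) (U : GaugeField (F.P p.K) j (SU N)) :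
    stepWeightPinOfRecord₁₃ F N θ p j (pairCfgAt (V := FluctV N) j V' U) =
      wOfRecord₉ F N θ.toStage9Params p (gOfRecord₁₃ F N θ p) j (seqAllLargeOfRecord F θ.ν θ.τ9.M (gOfRecord₁₃ F N θ p) p.K (j + 1))
        U ((avOfRecord F N p.K j).avg U) := by
  unfold stepWeightPinOfRecord₁₃
  rw [pairCfgAt_self]

/-- **THE PIN VALUE AT 11a's TWO-SCALE CONFIGURATION `(V₀, V₁) = (U, V₁)`** (generation `0`) is `w(s′)(U, Ū)` — dag-n11-d's hypothesis `hZ` of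
`slotsT_one_ae_eq_sect2Slot[_CoP]_of_zeta0_pin`. [cite: Balaban1988Convergent, (1.11) p.248, (2.21) p.258 (bookkeeping)] -/
theorem stepWeightPinOfRecord₁₃_pairCfg (V1 : GaugeField (F.P p.K) 1 (SU N)) (Uf : GaugeField (F.P p.K) 0 (SU N)) :
    stepWeightPinOfRecord₁₃ F N θ p 0 (pairCfg (V := FluctV N) V1 Uf) =
      wOfRecord₉ F N θ.toStage9Params p (gOfRecord₁₃ F N θ p) 0 (seqAllLargeOfRecord F θ.ν θ.τ9.M (gOfRecord₁₃ F N θ p) p.K 1)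
        Uf ((avOfRecord F N p.K 0).avg Uf) := by
  unfold stepWeightPinOfRecord₁₃
  rw [pairCfg_zero]

end PinValue

/-! ## §3. ★★★ The run-indexed residual of record and its three laws -/

section Residual

variable (F : T4Family) (N : ℕ) [NeZero N] (θ : Stage13Params F N) (p : B12.RunParams)

open Classical in
/-- **★★★ THE RUN-INDEXED RESIDUAL 𝐓-WEIGHT FAMILY OF RECORD** on the torus of the run `p` (the VALUE of node00-def-T's v1.6 field `Stage13RParams.Zr p` at node00-def-K0a's
witnesses; director-ym №174 (5)): at the generations `j < K` of the run, `ζ0_j(T) :=` the pin value `w_j(s′_j(p))(V_j, V̄_j)` (§2), `ζ0_j(∅) := 1 −` it, `ζ0_j(Y) := 0` for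
every other region label; at `j ≥ K` (no 𝐓-step of the run reads them) node00-def-K0b's uniform factor `ZtOfRecord`; `quad := 0` ([I]'s `𝒬_j` not constructed in the tree —
the Gaussian placeholder dag-n11-d's spec asks on `∅`).  dag-n11-d's generation-0 cure `exists_residual_clause_one_CoP` is this datum at `j = 0`; def-T memo §6's diagonal
family is this datum at every `j < K`.  NOT print's (1.11)∕(3.16)–(3.20) resummation as a formula in `Y` (H3); it agrees with it where the no-expansion diagonal reads it.
[cite: Balaban1988Convergent, (1.11) p.248, p.267, (3.16)–(3.20) pp.268–269, (2.21) p.258, (3.23)–(3.25) p.270; Balaban1987RG1, (1.5) p.261] -/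
def ZrOfRecord₁₃ : TkResidualW F N (FluctV N) p.K where
  ζ0 := fun j Y ω =>
    if j < p.K then (if Y = Set.univ then stepWeightPinOfRecord₁₃ F N θ p j ω else if Y = ∅ then 1 - stepWeightPinOfRecord₁₃ F N θ p j ω else 0)
    else (ZtOfRecord F N p.K).ζ0 j Y ω
  quad := fun _ _ _ => 0

variable {F N θ p}

/-- The scale-`0` lattice of a torus of record is non-empty, so `T ≠ ∅` as region labels. [cite: Balaban1988Convergent, (2.1) p.254 (bookkeeping)] -/
theorem univ_ne_empty_site (K : ℕ) : (Set.univ : Set (Site (F.P K) 0)) ≠ ∅ :=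
  Set.nonempty_iff_ne_empty.mp ⟨(fun _ => 0 : Fin (F.P K).d → ZMod ((F.P K).sitesPerDir 0)), Set.mem_univ _⟩

/-- `ζ0_j(T)` at a generation of the run is the pin value. [cite: Balaban1988Convergent, (1.11) p.248, p.267 (bookkeeping)] -/
theorem ZrOfRecord₁₃_ζ0_univ {j : ℕ} (hj : j < p.K) (ω : MultiCfg (F.P p.K) (SU N) (FluctV N)) :
    (ZrOfRecord₁₃ F N θ p).ζ0 j Set.univ ω = stepWeightPinOfRecord₁₃ F N θ p j ω := by
  simp only [ZrOfRecord₁₃, if_pos hj, if_true]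

/-- `ζ0_j(∅)` at a generation of the run is the complement `1 − ζ0_j(T)`. [cite: Balaban1988Convergent, (3.16)–(3.20) pp.268–269 (bookkeeping)] -/
theorem ZrOfRecord₁₃_ζ0_empty {j : ℕ} (hj : j < p.K) (ω : MultiCfg (F.P p.K) (SU N) (FluctV N)) :
    (ZrOfRecord₁₃ F N θ p).ζ0 j ∅ ω = 1 - stepWeightPinOfRecord₁₃ F N θ p j ω := by
  simp only [ZrOfRecord₁₃, if_pos hj, if_neg (Ne.symm (univ_ne_empty_site (F := F) p.K)), if_true]

/-- `ζ0_j(Y) = 0` at a generation of the run for every region label other than `T` and `∅` (located: by fiat, not print). [cite: Balaban1988Convergent, p.267 (bookkeeping)] -/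
theorem ZrOfRecord₁₃_ζ0_of_ne_of_ne {j : ℕ} (hj : j < p.K) {Y : Set (Site (F.P p.K) 0)} (hT : Y ≠ Set.univ) (h0 : Y ≠ ∅)
    (ω : MultiCfg (F.P p.K) (SU N) (FluctV N)) : (ZrOfRecord₁₃ F N θ p).ζ0 j Y ω = 0 := by
  simp only [ZrOfRecord₁₃, if_pos hj, if_neg hT, if_neg h0]

/-- Above the run's length the residual is node00-def-K0b's uniform factor. [cite: Balaban1988Convergent, p.267 (bookkeeping)] -/
theorem ZrOfRecord₁₃_ζ0_of_le {j : ℕ} (hj : p.K ≤ j) (Y : Set (Site (F.P p.K) 0)) (ω : MultiCfg (F.P p.K) (SU N) (FluctV N)) :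
    (ZrOfRecord₁₃ F N θ p).ζ0 j Y ω = (ZtOfRecord F N p.K).ζ0 j Y ω := by
  simp only [ZrOfRecord₁₃, if_neg (Nat.not_lt.mpr hj)]

/-- `quad ≡ 0` (the Gaussian placeholder). [cite: Balaban1988Convergent, (3.23) p.270 (bookkeeping)] -/
@[simp] theorem ZrOfRecord₁₃_quad (j : ℕ) (Λ' : Set (Site (F.P p.K) 0)) (ω : MultiCfg (F.P p.K) (SU N) (FluctV N)) :
    (ZrOfRecord₁₃ F N θ p).quad j Λ' ω = 0 := rfl

/-- **★ 12a's RESIDUAL LAW `ζ0 ≥ 0`** for the run-indexed residual of record (the future row `zrLaws p`), under unity of def-T's label residual `θ.ζ` (`0 ≤ w ≤ 1`).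
[cite: Balaban1988Convergent, p.267, (3.2)–(3.3) p.265, (3.16) p.268] -/
theorem laws_ZrOfRecord₁₃ (hζu : IsZetaUnity F N θ.ν θ.τ9.M θ.ζ) : (ZrOfRecord₁₃ F N θ p).Laws := by
  refine ⟨fun j Y ω => ?_⟩
  by_cases hj : j < p.K
  · by_cases hT : Y = Set.univ
    · subst hT
      rw [ZrOfRecord₁₃_ζ0_univ hj]
      exact stepWeightPinOfRecord₁₃_nonneg hζu j ω
    · by_cases h0 : Y = ∅
      · subst h0
        rw [ZrOfRecord₁₃_ζ0_empty hj]
        exact sub_nonneg.mpr (stepWeightPinOfRecord₁₃_le_one hζu j ω)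
      · rw [ZrOfRecord₁₃_ζ0_of_ne_of_ne hj hT h0]
  · rw [ZrOfRecord₁₃_ζ0_of_le (Nat.not_lt.mp hj)]
    exact (ZtOfRecord_ζ0_pos F N p.K j Y ω).le

/-- **★ 12b's LOCALITY LAW** for the run-indexed residual of record (the future row `zrLocal p`): `ζ0_j(Y)` reads the scale-`j` configuration only — the pin value
does (§2), K0b's factor reads nothing. [cite: Balaban1988Convergent, (3.2)–(3.3) p.265, p.267] -/
theorem localLaws_ZrOfRecord₁₃ : (ZrOfRecord₁₃ F N θ p).LocalLaws := by
  refine ⟨fun j Y ω ω' h => ?_⟩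
  -- arity-robust: `key` is the one-scale equation; `tauto` serves it under the one-scale row AND under the two-scale row of record
  -- (`ω j = ω' j → (ω (j+1)).1 = (ω' (j+1)).1 → …`, [B14] (3.1) p.264), where one more hypothesis is in context.
  have key : (ZrOfRecord₁₃ F N θ p).ζ0 j Y ω = (ZrOfRecord₁₃ F N θ p).ζ0 j Y ω' := by
    by_cases hj : j < p.K
    · simp only [ZrOfRecord₁₃, if_pos hj, stepWeightPinOfRecord₁₃_local j h]
    · rw [ZrOfRecord₁₃_ζ0_of_le (Nat.not_lt.mp hj), ZrOfRecord₁₃_ζ0_of_le (Nat.not_lt.mp hj)]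
      rfl
  tauto

/-- **★ PRINT'S PARTITION OF UNITY AT EVERY GENERATION** for the run-indexed residual of record (the future guard `Stage13RParams.ZrUnity` at the pin):
`Σᶠ_Y ζ0_j(Y)(ω) = ζ0_j(T) + ζ0_j(∅) = 1` at `j < K`, K0b's `finsum_ζ0_ZtOfRecord` above. [cite: Balaban1988Convergent, (3.16)–(3.20) pp.268–269] -/
theorem finsum_ζ0_ZrOfRecord₁₃ (j : ℕ) (ω : MultiCfg (F.P p.K) (SU N) (FluctV N)) :
    (∑ᶠ Y : Set (Site (F.P p.K) 0), (ZrOfRecord₁₃ F N θ p).ζ0 j Y ω) = 1 := by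
  classical
  by_cases hj : j < p.K
  · haveI : Fintype (Set (Site (F.P p.K) 0)) := Fintype.ofFinite _
    have hne : (Set.univ : Set (Site (F.P p.K) 0)) ≠ ∅ := univ_ne_empty_site (F := F) p.K
    rw [finsum_eq_sum_of_fintype,
      Finset.sum_eq_add_of_mem (Set.univ : Set (Site (F.P p.K) 0)) ∅ (Finset.mem_univ _) (Finset.mem_univ _) hne]
    · rw [ZrOfRecord₁₃_ζ0_univ hj, ZrOfRecord₁₃_ζ0_empty hj]
      ring
    · intro Y _ hY
      exact ZrOfRecord₁₃_ζ0_of_ne_of_ne hj hY.1 hY.2 ω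
  · rw [show (fun Y : Set (Site (F.P p.K) 0) => (ZrOfRecord₁₃ F N θ p).ζ0 j Y ω) = fun Y => (ZtOfRecord F N p.K).ζ0 j Y ω from
      funext fun Y => ZrOfRecord₁₃_ζ0_of_le (Nat.not_lt.mp hj) Y ω]
    exact finsum_ζ0_ZtOfRecord F N p.K j ω

/-- **THE GENERATION-0 PIN FACE** (dag-n11-d's hypothesis `hZ` of `slotsT_one_ae_eq_sect2Slot[_CoP]_of_zeta0_pin`, `0 < K`): at 11a's two-scale configuration
`ζ0_0(T)(U, V₁) = w(s′₀)(U, Ū)`. [cite: Balaban1988Convergent, (1.11) p.248, (2.21) p.258, (3.25) p.270] -/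
theorem ZrOfRecord₁₃_ζ0_zero_univ_pairCfg (hK : 0 < p.K) (V1 : GaugeField (F.P p.K) 1 (SU N)) (Uf : GaugeField (F.P p.K) 0 (SU N)) :
    (ZrOfRecord₁₃ F N θ p).ζ0 0 Set.univ (pairCfg (V := FluctV N) V1 Uf) =
      wOfRecord₉ F N θ.toStage9Params p (gOfRecord₁₃ F N θ p) 0 (seqAllLargeOfRecord F θ.ν θ.τ9.M (gOfRecord₁₃ F N θ p) p.K 1)
        Uf ((avOfRecord F N p.K 0).avg Uf) := by
  rw [ZrOfRecord₁₃_ζ0_univ hK, stepWeightPinOfRecord₁₃_pairCfg]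

/-- **THE GENERATION-`j` PIN FACE** (dag-n11-d's generation-`j` spec `slotsT_succ_ae_eq_sect2Slot_of_zetaSpecAt` with `c = 1`, `j < K`): at g3's two-scale configuration
`ζ0_j(T)(U, V′) = w_j(s′_j)(U, Ū)`. [cite: Balaban1988Convergent, (2.21) p.258, (3.24)–(3.25) p.270] -/
theorem ZrOfRecord₁₃_ζ0_univ_pairCfgAt {j : ℕ} (hj : j < p.K) (V' : GaugeField (F.P p.K) (j + 1) (SU N)) (U : GaugeField (F.P p.K) j (SU N)) :
    (ZrOfRecord₁₃ F N θ p).ζ0 j Set.univ (pairCfgAt (V := FluctV N) j V' U) =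
      wOfRecord₉ F N θ.toStage9Params p (gOfRecord₁₃ F N θ p) j (seqAllLargeOfRecord F θ.ν θ.τ9.M (gOfRecord₁₃ F N θ p) p.K (j + 1))
        U ((avOfRecord F N p.K j).avg U) := by
  rw [ZrOfRecord₁₃_ζ0_univ hj, stepWeightPinOfRecord₁₃_pairCfgAt]

/-- The `quad` pin face at 11a's two-scale configuration (dag-n11-d's hypothesis `hq`): `quad_0(∅)(U, V₁) = 0`. [cite: Balaban1988Convergent, (3.23) p.270 (bookkeeping)] -/
theorem ZrOfRecord₁₃_quad_zero_empty_pairCfg (V1 : GaugeField (F.P p.K) 1 (SU N)) (Uf : GaugeField (F.P p.K) 0 (SU N)) :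
    (ZrOfRecord₁₃ F N θ p).quad 0 ∅ (pairCfg (V := FluctV N) V1 Uf) = 0 := rfl

end Residual

end Literature.MathematicalPhysics.QuantumFieldTheory.Balaban1983to89.Node00

end
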